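import Summits.NavierStokesRegularity.NavierStokesRegularity.Theorems.ExtremiserTransienceTightOrChainDefs
import HarnessLib

/-!
# Route `ExtremiserTransience`, crux `NearExtremalTransiencePerFlow` (stmt-NavierStokesRegularity-26567),
# LINE g10-γ «multiscale crowding»: THE VOCABULARY OF THE LINE (texts of record)

Texts of record, VERBATIM §0/§1/§1b of the skeleton of record `Cruxes/NearExtremalTransiencePerFlow/Lines/multiscale_crowding.lean`
(planner ns-idea-5 g10, skeleton sha 1c5b3d804149; `E3` spelled out as `EuclideanSpace ℝ (Fin 3)`), restricted to what is NOT already a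
text of record: `CrowdingConfig`, `MultiscaleCrowding`, `MultiscaleLedgerCount` (L3ᵐˢ), `LocalCrowdingLiouville`, `TightOrCrowding` (T♭, the
heart) and `TightOrCrowdingMembers` (T♭ at member level).  Reused by name (same constants, so the workfile's statements unfold to these):
`HasLinGrowthAllTime`, `dissMeasure`, `ViolatorDissipation` (`…DissipationLedger`, ns-net-p1 g11), `UniformDissipationBudget`, `ChainUpTo`,
`ChainsOfEveryLength` (`…TightOrChain`, ns-net-p1 g11), `NearExtremalFamily`, `IsExtremalSlice` (`…MemberSelection`).  The proved parts of the
line (L3ᵐˢ `multiscaleLedgerCount_holds`, `localCrowdingLiouville`, `tightOrCrowding_of_members`, the composition `…_of_tightOrCrowding`) are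
ported in the sibling proof files.  Author of this port: prover seat ns-net-p2 (g10).

HONEST FRAMING: definitions only; nothing about Navier–Stokes regularity or blow-up is proved here; no summit is proved by a line.
-/

noncomputable section

open scoped Topology InnerProductSpace RealInnerProductSpace ENNReal ContDiff
open MeasureTheory Filter Set Metric Function
open Literature.Analysis Literature.Analysis.FluidPDE
open Summit.NavierStokesRegularity.NavierStokesRegularity.Theses.ExtremiserTransience
open Summit.NavierStokesRegularity.NavierStokesRegularity.Theorems
open Summit.NavierStokesRegularity.NavierStokesRegularity.Theorems.NearExtremalTransiencePerFlow
open Summit.NavierStokesRegularity.NavierStokesRegularity.Theorems.NearExtremalTransiencePerFlow.ZoneTransversality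
open Summit.NavierStokesRegularity.NavierStokesRegularity.Theorems.NearExtremalTransiencePerFlow.MemberSelection
open Summit.NavierStokesRegularity.NavierStokesRegularity.Theorems.NearExtremalTransiencePerFlow.DissipationLedger
  (HasLinGrowthAllTime dissMeasure ViolatorDissipation)
open Summit.NavierStokesRegularity.NavierStokesRegularity.Theorems.NearExtremalTransiencePerFlow.TightOrChain
  (UniformDissipationBudget ChainUpTo ChainsOfEveryLength)

namespace Summit.NavierStokesRegularity.NavierStokesRegularity.Theorems

set_option linter.dupNamespace false

namespace NearExtremalTransiencePerFlow.MultiscaleCrowding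

/-! ## §0 Crowding -/

/-- A CROWDING CONFIGURATION with `m` scales over the base scale `ℓ₀`, density `C`, level `η`, for a field `w`: a centre `z₀`, a radius `L`
and distinct scale exponents `k 0 < k 1 < ⋯` such that each scale `ℓ_j := ℓ₀·6^{k j}` (`j < m`) is `≤ L` and the level set
`{‖w‖ ≥ η} ∩ B̄(z₀, L)` contains a finite set of at least `C·L/ℓ_j` points pairwise at distance `≥ ℓ_j`.  (Covering-number form of
«one-dimensional with density `C` at scale `ℓ_j` inside `B̄(z₀,L)`»; the ratio `6` between admissible scales matches the ledger's epochs.) -/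
def CrowdingConfig (m : ℕ) (ℓ₀ C η : ℝ) (w : (EuclideanSpace ℝ (Fin 3)) → (EuclideanSpace ℝ (Fin 3))) : Prop :=
  ∃ (z₀ : (EuclideanSpace ℝ (Fin 3))) (L : ℝ) (k : ℕ → ℕ), StrictMono k ∧ (∀ j : ℕ, j < m → ℓ₀ * 6 ^ (k j) ≤ L) ∧
    ∀ j : ℕ, j < m → ∃ S : Finset (EuclideanSpace ℝ (Fin 3)), C * L / (ℓ₀ * 6 ^ (k j)) ≤ (S.card : ℝ) ∧
      (∀ z ∈ S, ‖z - z₀‖ ≤ L ∧ η ≤ ‖w z‖) ∧ (∀ z ∈ S, ∀ z' ∈ S, z ≠ z' → ℓ₀ * 6 ^ (k j) ≤ ‖z - z'‖)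

/-- MULTISCALE CROWDING (density `C`, level `η`): crowding configurations with any number of scales over any base scale. -/
def MultiscaleCrowding (C η : ℝ) (w : (EuclideanSpace ℝ (Fin 3)) → (EuclideanSpace ℝ (Fin 3))) : Prop :=
  ∀ (m : ℕ) (ℓ₀ : ℝ), 0 < ℓ₀ → CrowdingConfig m ℓ₀ C η w


/-! ## §1 The statements of the line -/

/-- (L3ᵐˢ — PROVED below, `multiscaleLedgerCount_holds`) THE MULTISCALE LEDGER COUNT.  Constants `s < 0`, `ρ, c, D > 0`, `0 < a < 1`, `E`,
density `C > 0`; base scale `ℓ₀ := (2ρ + 2D + 2)√(-s)`.  There is a NUMBER OF SCALES `m` (depending on these constants only) such that for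
every measure `μ`, predicate `P`, centre `x₀`, radius `L` and distinct exponents `k`: (Crowd) at each of the `m` scales `ℓ₀ 6^{k j} ≤ L` a
finite `ℓ₀6^{k j}`-separated set of `≥ C·L/(ℓ₀ 6^{k j})` `P`-points at time `s` in `B̄(x₀, L)`, (Per) one-step backward propagation with
drift `ρ√(-τ)`, (Spend) `c√(-τ)` per `P`-point on its box, (Budget) `μ([τ₁,τ₂] × B(x₀,R)) ≤ E·R` whenever `-τ₁ ≤ R²` — are contradictory. -/
def MultiscaleLedgerCount : Prop :=
  ∀ (s ρ c D a E C : ℝ), s < 0 → 0 < ρ → 0 < c → 0 < D → 0 < a → a < 1 → 0 < C →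
    ∃ m : ℕ, ∀ (μ : Measure (ℝ × (EuclideanSpace ℝ (Fin 3)))) (P : ℝ → (EuclideanSpace ℝ (Fin 3)) → Prop) (x₀ : (EuclideanSpace ℝ (Fin 3))) (L : ℝ) (k : ℕ → ℕ),
      StrictMono k →
      (∀ j : ℕ, j < m → (2 * ρ + 2 * D + 2) * Real.sqrt (-s) * 6 ^ (k j) ≤ L) →
      (∀ j : ℕ, j < m → ∃ S : Finset (EuclideanSpace ℝ (Fin 3)),
          C * L / ((2 * ρ + 2 * D + 2) * Real.sqrt (-s) * 6 ^ (k j)) ≤ (S.card : ℝ) ∧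
          (∀ z ∈ S, ‖z - x₀‖ ≤ L ∧ P s z) ∧
          (∀ z ∈ S, ∀ z' ∈ S, z ≠ z' → (2 * ρ + 2 * D + 2) * Real.sqrt (-s) * 6 ^ (k j) ≤ ‖z - z'‖)) →
      (∀ (τ : ℝ) (x : (EuclideanSpace ℝ (Fin 3))), τ < 0 → P τ x → ∃ x' : (EuclideanSpace ℝ (Fin 3)), ‖x' - x‖ ≤ ρ * Real.sqrt (-τ) ∧ P (36 * τ) x') →
      (∀ (τ : ℝ) (x : (EuclideanSpace ℝ (Fin 3))), τ < 0 → P τ x →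
        ENNReal.ofReal (c * Real.sqrt (-τ)) ≤ μ (Set.Icc ((1 + a) * τ) τ ×ˢ Metric.ball x (D * Real.sqrt (-τ)))) →
      (∀ (R τ₁ τ₂ : ℝ), 0 < R → τ₁ < τ₂ → τ₂ < 0 → -τ₁ ≤ R ^ 2 →
        μ (Set.Icc τ₁ τ₂ ×ˢ Metric.ball x₀ R) ≤ ENNReal.ofReal (E * R)) →
      False

/-- (THE LOCAL CROWDING LIOUVILLE THEOREM — kernel-checked below from L1ᵘ, L2, L3ᵐˢ and the landed backward-cone propagation): for all
`K, A, C > 0, η > 0, s < 0` there are a number of scales `m` and a base scale `ℓ₀ > 0` such that NO slice `W s` of a Type-I ancient mild field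
(constant `K`) with all-time linear growth `A` carries an `(m, ℓ₀, C, η)` crowding configuration.  It implies β's `LocalChainLiouville` and
α's `UbiquitousSliceLiouville`, and kills by name every limit in the non-tight branch of T♭. -/
def LocalCrowdingLiouville : Prop :=
  ∀ (K A C η s : ℝ), s < 0 → 0 < C → 0 < η → ∃ (m : ℕ) (ℓ₀ : ℝ), 0 < ℓ₀ ∧ ∀ (W : ℝ → (EuclideanSpace ℝ (Fin 3)) → (EuclideanSpace ℝ (Fin 3))),
    IsTypeIAncientMild K W → HasLinGrowthAllTime A W → ¬ CrowdingConfig m ℓ₀ C η (W s)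

/-- (T♭ — THE HEART, XL) TIGHT-OR-CROWDING: a near-extremal height-`1` family (`NearExtremalFamily v Λ Θ ε`) whose members eventually have
linear local-energy growth `A` admits centres `y`, a subsequence `φ` and a pointwise limit `W₀` of the translates `v (φ n) (y (φ n) + ·)`
such that EITHER `W₀` is an exactly extremal extended slice (`IsExtremalSlice`, the tight branch of concentration-compactness) OR `W₀` exhibits
multiscale crowding with some density `C > 0` at some level `η > 0` (the non-tight branch, in the weakest form an energy ledger can use).
Mechanism: as for β's T♮ (tight profiles ⇒ `C^∞_loc` convergence + `extendedSharp` + Fatou ⇒ extremal limit; no tight centring ⇒ the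
Cauchy–Schwarz weight delocalises over unboundedly many unit cells confined by linear growth), but the conclusion asked of the delocalised
branch is only COUNTING: `≥ C·L/ℓ` cells that are `ℓ`-separated in a ball of radius `L`, on `m` scales, for every `m` — no connectedness, no
fixed thickness.  Implied by T♮ (β) and by C1 ∧ C2 (α).  Why it might fail: near-extremisers whose level sets are hierarchically dilute of
box-dimension `< 1` (the one geometry no ledger sees); the DILUTE-GAP rows (j327037: DILUTION-MONOTONE) are the instrument.  Sources: Lions'
concentration-compactness (1984); Frostman / multiscale covering numbers; this crux's `Lines/tight_or_chain.lean`, `Lines/dissipation_ledger.lean`. -/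
def TightOrCrowding : Prop :=
  ∀ (v : ℕ → (EuclideanSpace ℝ (Fin 3)) → (EuclideanSpace ℝ (Fin 3))) (Λ : ℕ → ℝ) (Θ : ℝ) (ε : ℕ → ℝ) (A : ℝ),
    NearExtremalFamily v Λ Θ ε →
    (∀ᶠ n in atTop, ∀ (x : (EuclideanSpace ℝ (Fin 3))) (R : ℝ), 0 < R → ∫ z in Metric.ball x R, ‖v n z‖ ^ 2 ≤ A * R) →
    ∃ (y : ℕ → (EuclideanSpace ℝ (Fin 3))) (φ : ℕ → ℕ) (W₀ : (EuclideanSpace ℝ (Fin 3)) → (EuclideanSpace ℝ (Fin 3))), StrictMono φ ∧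
      (∀ z : (EuclideanSpace ℝ (Fin 3)), Tendsto (fun n => v (φ n) (y (φ n) + z)) atTop (𝓝 (W₀ z))) ∧
      (IsExtremalSlice W₀ ∨ ∃ C η : ℝ, 0 < C ∧ 0 < η ∧ MultiscaleCrowding C η W₀)

/-- **T♭ at MEMBER level** (what a prover actually establishes): the same dichotomy, with the crowding branch stated on the MEMBERS about the
centres `y (φ n)`: for every `m, ℓ₀ > 0` a radius `L` and exponents `k` (independent of `n`) such that, scale by scale, EVENTUALLY every
member carries the separated level points in `B̄(y (φ n), L)`. -/
def TightOrCrowdingMembers : Prop :=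
  ∀ (v : ℕ → (EuclideanSpace ℝ (Fin 3)) → (EuclideanSpace ℝ (Fin 3))) (Λ : ℕ → ℝ) (Θ : ℝ) (ε : ℕ → ℝ) (A : ℝ),
    NearExtremalFamily v Λ Θ ε →
    (∀ᶠ n in atTop, ∀ (x : (EuclideanSpace ℝ (Fin 3))) (R : ℝ), 0 < R → ∫ z in Metric.ball x R, ‖v n z‖ ^ 2 ≤ A * R) →
    ∃ (y : ℕ → (EuclideanSpace ℝ (Fin 3))) (φ : ℕ → ℕ) (W₀ : (EuclideanSpace ℝ (Fin 3)) → (EuclideanSpace ℝ (Fin 3))), StrictMono φ ∧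
      (∀ z : (EuclideanSpace ℝ (Fin 3)), Tendsto (fun n => v (φ n) (y (φ n) + z)) atTop (𝓝 (W₀ z))) ∧
      (IsExtremalSlice W₀ ∨ ∃ C η : ℝ, 0 < C ∧ 0 < η ∧ ∀ (m : ℕ) (ℓ₀ : ℝ), 0 < ℓ₀ →
        ∃ (L : ℝ) (k : ℕ → ℕ), StrictMono k ∧ (∀ j : ℕ, j < m → ℓ₀ * 6 ^ (k j) ≤ L) ∧
          ∀ j : ℕ, j < m → ∀ᶠ n in atTop, ∃ S : Finset (EuclideanSpace ℝ (Fin 3)), C * L / (ℓ₀ * 6 ^ (k j)) ≤ (S.card : ℝ) ∧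
            (∀ z ∈ S, ‖z - y (φ n)‖ ≤ L ∧ η ≤ ‖v (φ n) z‖) ∧
            (∀ z ∈ S, ∀ z' ∈ S, z ≠ z' → ℓ₀ * 6 ^ (k j) ≤ ‖z - z'‖))

end NearExtremalTransiencePerFlow.MultiscaleCrowding

end Summit.NavierStokesRegularity.NavierStokesRegularity.Theorems

end
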